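import Mathlib
import Literature.Analysis.Fourier.HilbertTransformLineL2Density
import HarnessLib

/-!
# The velocity bound of the SHEET-ℝ frame: `|∫₀^ξ Hf| ≤ (π/(4√c))^{1/2} ‖f‖_{L²((c+ξ²)dξ)}` for odd `f`

`Literature/Analysis/Fourier`. For an ODD real `f` of the energy class (`f ∈ L¹ ∩ L²`, `x·f ∈ L²`, symmetric p.v.
integrand integrable on `(0,∞)` at every point) the primitive `𝒰_f(ξ) = ∫₀^ξ Hf` of its (even, square-integrable)
Hilbert transform is BOUNDED, uniformly in `ξ`:

  `(∫₀^ξ Hf)² ≤ (π/(4√c)) · ∫ (c + x²) f(x)² dx`   for every `c > 0` and every `ξ`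

(`sq_integral_hilbertTransform_le`). PROOF: Cauchy–Schwarz on `(0, |ξ|]` against the weight `(c + x²)^{±1/2}`,
`∫_{(0,∞)} dx/(c+x²) = π/(2√c)` (`integral_Ioi_inv_add_sq`), evenness of `Hf` (`hilbertTransform_neg_arg_of_odd`:
the half-line carries half the weighted mass), and the weighted isometry `∫(c+x²)(Hf)² = ∫(c+x²)f²`
(`integral_weight_mul_hilbertTransform_sq_eq_of_memLp`). Also recorded: the elementary embedding
`L²((c+ξ²)dξ) ⊂ L¹` (`integrable_of_integrable_weight_mul_sq`, by `2|f| ≤ (c+x²)⁻¹ + (c+x²)f²`), which discharges the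
`L¹` hypothesis of the weighted isometry on the energy class. This is identity (1c) / the second clause of (E4) of the
SHEET-ℝ certificate frame (cell ns-blowup, zone Z3, case Z3-SR-CERT: `HOME/selfsim/SHEET-R-FRAME-NOTE-v2.md` §1,
`HOME/profile/cert/impl1/SHEET-R-PRICE-impl1.md` (E4): the constant `(π/(4L))^{1/2}` at `c = L²`), i.e. a Cauchy–Schwarz
corollary of the `L²` isometry [cite: Grafakos2014, eq. (5.1.14)]. No definitions. WHAT THIS IS NOT: not Navier–Stokes.
-/

namespace Literature.Analysis.Fourier

open _root_.MeasureTheory Set Filter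
open scoped Real Topology ENNReal

/-! ### The weight integral `∫_{(0,∞)} dx/(c+x²) = π/(2√c)` and the embedding `L²_w ⊂ L¹` -/

/-- `∫_{(0,∞)} (c + x²)⁻¹ dx = π/(2√c)` for `c > 0` (substitution `x = √c·u` in `∫ (1+u²)⁻¹ = arctan`).
[cite: Grafakos2014, Ex. 5.1.8 (Poisson kernel normalisation)] -/
theorem integral_Ioi_inv_add_sq {c : ℝ} (hc : 0 < c) :
    ∫ x in Ioi (0 : ℝ), (c + x ^ 2)⁻¹ = π / (2 * Real.sqrt c) := by
  set s : ℝ := Real.sqrt c with hs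
  have hs0 : 0 < s := Real.sqrt_pos.2 hc
  have hsc : s ^ 2 = c := Real.sq_sqrt hc.le
  have hfun : (fun x : ℝ => (c + x ^ 2)⁻¹) = fun x => c⁻¹ * (1 + (s⁻¹ * x) ^ 2)⁻¹ := by
    funext x
    rw [← hsc]
    field_simp
  rw [hfun, integral_const_mul, integral_comp_mul_left_Ioi (fun u : ℝ => (1 + u ^ 2)⁻¹) 0 (inv_pos.2 hs0),
    mul_zero, integral_Ioi_inv_one_add_sq, Real.arctan_zero, sub_zero, smul_eq_mul, inv_inv, ← hsc]
  field_simp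

/-- The weight `(c + x²)⁻¹`, `c > 0`, is integrable on `ℝ`. [folklore] -/
private theorem integrable_inv_add_sq {c : ℝ} (hc : 0 < c) : Integrable fun x : ℝ => (c + x ^ 2)⁻¹ := by
  have hm : 0 < min c 1 := lt_min hc one_pos
  refine (integrable_inv_one_add_sq.const_mul (min c 1)⁻¹).mono' ?_ (ae_of_all _ fun x => ?_)
  · exact (Continuous.inv₀ (by fun_prop) fun x => (by positivity : c + x ^ 2 ≠ 0)).aestronglyMeasurable
  · have hw : 0 < c + x ^ 2 := by positivity
    rw [Real.norm_eq_abs, abs_of_pos (inv_pos.2 hw), ← mul_inv, inv_le_inv₀ hw (by positivity)]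
    have h1 : min c 1 ≤ c := min_le_left _ _
    have h2 : min c 1 ≤ 1 := min_le_right _ _
    nlinarith [sq_nonneg x, mul_nonneg (sub_nonneg.2 h2) (sq_nonneg x)]

/-- **`L²((c+ξ²)dξ) ⊂ L¹(ℝ)`** for `c > 0`: if `f` is a.e.-strongly measurable and `(c + x²)·f(x)²` is integrable then
`f` is integrable (pointwise `2|f| ≤ (c+x²)⁻¹ + (c+x²)f²`). This discharges the `L¹` hypothesis of the weighted
isometry on the energy class of the SHEET-ℝ frame. [cite: Grafakos2014, eq. (5.1.14) (context: the weighted `L²` class)] -/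
theorem integrable_of_integrable_weight_mul_sq {f : ℝ → ℝ} {c : ℝ} (hc : 0 < c) (hfm : AEStronglyMeasurable f volume)
    (hw : Integrable fun x => (c + x ^ 2) * f x ^ 2) : Integrable f := by
  refine Integrable.mono' (((integrable_inv_add_sq hc).add hw).div_const 2) hfm (ae_of_all _ fun x => ?_)
  have hwx : 0 < c + x ^ 2 := by positivity
  rw [Real.norm_eq_abs, le_div_iff₀ (by norm_num : (0 : ℝ) < 2)]
  -- `2|f| w ≤ 1 + w² f²` divided by `w`
  have key : |f x| * 2 * (c + x ^ 2) ≤ ((c + x ^ 2)⁻¹ + (c + x ^ 2) * f x ^ 2) * (c + x ^ 2) := by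
    rw [add_mul, inv_mul_cancel₀ hwx.ne', ← sq_abs (f x)]
    nlinarith [sq_nonneg ((c + x ^ 2) * |f x| - 1), abs_nonneg (f x), hwx]
  exact le_of_mul_le_mul_right key hwx

/-! ### Cauchy–Schwarz on `(0, η]` against the weight -/

/-- For `h ∈ L²` and `η ≥ 0`, `c > 0`: `(∫₀^η h)² ≤ (∫_{(0,η]} (c+x²)⁻¹)·(∫_{(0,η]} (c+x²) h²)`. [folklore] -/
private theorem sq_intervalIntegral_le_weight {h : ℝ → ℝ} (hh : MemLp h 2) {c : ℝ} (hc : 0 < c) {η : ℝ}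
    (hη : 0 ≤ η) :
    (∫ t in (0 : ℝ)..η, h t) ^ 2 ≤
      (∫ x in Ioc 0 η, (c + x ^ 2)⁻¹) * ∫ x in Ioc 0 η, (c + x ^ 2) * h x ^ 2 := by
  rw [intervalIntegral.integral_of_le hη]
  set μ : Measure ℝ := volume.restrict (Ioc 0 η) with hμ
  haveI : IsFiniteMeasure μ := ⟨by rw [hμ, Measure.restrict_apply_univ]; exact measure_Ioc_lt_top⟩
  -- the two Cauchy–Schwarz factors
  set a : ℝ → ℝ := fun x => (Real.sqrt (c + x ^ 2))⁻¹ with ha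
  set b : ℝ → ℝ := fun x => Real.sqrt (c + x ^ 2) * ‖h x‖ with hb
  have hwpos : ∀ x : ℝ, 0 < c + x ^ 2 := fun x => by positivity
  have hspos : ∀ x : ℝ, 0 < Real.sqrt (c + x ^ 2) := fun x => Real.sqrt_pos.2 (hwpos x)
  have hab : ∀ x, a x * b x = ‖h x‖ := by
    intro x; simp only [ha, hb]; field_simp
  have ha_nonneg : ∀ x, 0 ≤ a x := fun x => (inv_pos.2 (hspos x)).le
  have hb_nonneg : ∀ x, 0 ≤ b x := fun x => mul_nonneg (hspos x).le (norm_nonneg _)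
  have ha_cont : Continuous a := by
    simp only [ha]
    exact Continuous.inv₀ (by fun_prop) fun x => (hspos x).ne'
  have ha_mem : MemLp a (ENNReal.ofReal 2) μ := by
    refine memLp_of_bounded (a := 0) (b := (Real.sqrt c)⁻¹) (ae_of_all _ fun x => ⟨ha_nonneg x, ?_⟩)
      ha_cont.aestronglyMeasurable _
    simp only [ha]
    exact inv_anti₀ (Real.sqrt_pos.2 hc) (Real.sqrt_le_sqrt (by nlinarith [sq_nonneg x]))
  have hb_mem : MemLp b (ENNReal.ofReal 2) μ := by
    have h2 : MemLp (fun x => Real.sqrt (c + η ^ 2) * ‖h x‖) (ENNReal.ofReal 2) μ := by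
      have := ((hh.restrict (Ioc 0 η)).norm).const_mul (Real.sqrt (c + η ^ 2))
      simpa using this
    refine h2.of_le ((by fun_prop : Continuous fun x => Real.sqrt (c + x ^ 2)).aestronglyMeasurable.mul
      (hh.restrict (Ioc 0 η)).1.norm) ?_
    rw [hμ, ae_restrict_iff' measurableSet_Ioc]
    refine ae_of_all _ fun x hx => ?_
    simp only [hb, Real.norm_eq_abs, abs_mul, abs_abs, abs_of_pos (hspos x)]
    rw [abs_of_pos (Real.sqrt_pos.2 (by positivity))]
    exact mul_le_mul_of_nonneg_right (Real.sqrt_le_sqrt (by nlinarith [hx.1, hx.2])) (abs_nonneg _)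
  have hCS := integral_mul_le_Lp_mul_Lq_of_nonneg Real.HolderConjugate.two_two (ae_of_all _ ha_nonneg)
    (ae_of_all _ hb_nonneg) ha_mem hb_mem
  -- identify the pieces
  have ea : ∀ x, a x ^ (2 : ℝ) = (c + x ^ 2)⁻¹ := by
    intro x; simp only [ha]; rw [Real.rpow_two, inv_pow, Real.sq_sqrt (hwpos x).le]
  have eb : ∀ x, b x ^ (2 : ℝ) = (c + x ^ 2) * h x ^ 2 := by
    intro x; simp only [hb]
    rw [Real.rpow_two, mul_pow, Real.sq_sqrt (hwpos x).le, Real.norm_eq_abs, sq_abs]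
  simp_rw [hab, ea, eb] at hCS
  have hA : 0 ≤ ∫ x, (c + x ^ 2)⁻¹ ∂μ := integral_nonneg fun x => (inv_pos.2 (hwpos x)).le
  have hB : 0 ≤ ∫ x, (c + x ^ 2) * h x ^ 2 ∂μ := integral_nonneg fun x => by positivity
  have h1 : |∫ x, h x ∂μ| ≤ ∫ x, ‖h x‖ ∂μ := by
    rw [← Real.norm_eq_abs]; exact norm_integral_le_integral_norm _
  have h2 : |∫ x, h x ∂μ| ≤ (∫ x, (c + x ^ 2)⁻¹ ∂μ) ^ (1 / (2 : ℝ)) * (∫ x, (c + x ^ 2) * h x ^ 2 ∂μ) ^ (1 / (2 : ℝ)) :=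
    h1.trans hCS
  have h3 := pow_le_pow_left₀ (abs_nonneg _) h2 2
  rw [sq_abs, mul_pow, ← Real.sqrt_eq_rpow, ← Real.sqrt_eq_rpow, Real.sq_sqrt hA, Real.sq_sqrt hB] at h3
  exact h3

/-! ### The velocity bound -/

/-- **Velocity bound (SHEET-ℝ frame (1c) / (E4))**: for an odd real `f` with `f ∈ L¹ ∩ L²`, `x·f ∈ L²` and symmetric
p.v. integrand integrable on `(0,∞)` at every point, and every `c > 0`, `ξ ∈ ℝ`:
`(∫₀^ξ Hf)² ≤ (π/(4√c)) · ∫ (c + x²) f(x)² dx` — the velocity `𝒰_f = ∫₀^ξ Hf` of a weighted-`L²` vorticity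
perturbation is bounded by `(π/(4√c))^{1/2}‖f‖_{L²(c+ξ²)}` (at `c = L²`: `(π/(4L))^{1/2}`; at `c = 2`: `0.745…`).
[cite: Grafakos2014, eq. (5.1.14) (isometry; this is its Cauchy–Schwarz corollary)] -/
theorem sq_integral_hilbertTransform_le {f : ℝ → ℝ} (hf : Integrable f) (hodd : ∀ y, f (-y) = -f y)
    (hf2 : MemLp f 2) (hxf2 : MemLp (fun y => y * f y) 2)
    (hint : ∀ x : ℝ, IntegrableOn (fun t => (f (x - t) - f (x + t)) / t) (Ioi 0)) {c : ℝ} (hc : 0 < c)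
    (ξ : ℝ) :
    (∫ t in (0 : ℝ)..ξ, hilbertTransform f t) ^ 2 ≤ π / (4 * Real.sqrt c) * ∫ x, (c + x ^ 2) * f x ^ 2 := by
  have heven : ∀ x, hilbertTransform f (-x) = hilbertTransform f x := hilbertTransform_neg_arg_of_odd hodd
  have hH : MemLp (hilbertTransform f) 2 := memLp_two_hilbertTransform hf hf2 (ae_of_all _ hint)
  obtain ⟨hxH, hW⟩ := integral_weight_mul_hilbertTransform_sq_eq_of_memLp hf hodd hf2 hxf2 hint c
  -- integrability of the weighted square of `Hf`
  have hwH : Integrable fun x => (c + x ^ 2) * hilbertTransform f x ^ 2 := by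
    have e : (fun x => (c + x ^ 2) * hilbertTransform f x ^ 2) =
        fun x => c * hilbertTransform f x ^ 2 + (x * hilbertTransform f x) ^ 2 := by funext x; ring
    rw [e]; exact (hH.integrable_sq.const_mul c).add hxH.integrable_sq
  -- half-line masses: evenness
  have hhalf : ∫ x in Ioi (0 : ℝ), (c + x ^ 2) * hilbertTransform f x ^ 2 =
      (1 / 2) * ∫ x, (c + x ^ 2) * f x ^ 2 := by
    rw [← hW]
    have habs : (fun x : ℝ => (c + |x| ^ 2) * hilbertTransform f |x| ^ 2) =
        fun x => (c + x ^ 2) * hilbertTransform f x ^ 2 := by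
      funext x
      rcases le_or_gt 0 x with hx | hx
      · rw [abs_of_nonneg hx]
      · rw [abs_of_neg hx, heven, neg_sq]
    have h := integral_comp_abs (f := fun x => (c + x ^ 2) * hilbertTransform f x ^ 2)
    rw [habs] at h
    rw [h]; ring
  have hwint : ∫ x in Ioi (0 : ℝ), (c + x ^ 2)⁻¹ = π / (2 * Real.sqrt c) := integral_Ioi_inv_add_sq hc
  -- the bound for `η ≥ 0`
  have key : ∀ η : ℝ, 0 ≤ η → (∫ t in (0 : ℝ)..η, hilbertTransform f t) ^ 2 ≤
      π / (4 * Real.sqrt c) * ∫ x, (c + x ^ 2) * f x ^ 2 := by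
    intro η hη
    refine (sq_intervalIntegral_le_weight hH hc hη).trans ?_
    have m1 : ∫ x in Ioc 0 η, (c + x ^ 2)⁻¹ ≤ ∫ x in Ioi (0 : ℝ), (c + x ^ 2)⁻¹ :=
      setIntegral_mono_set (integrable_inv_add_sq hc).integrableOn
        (ae_of_all _ fun x => (inv_pos.2 (by positivity : (0 : ℝ) < c + x ^ 2)).le)
        (ae_of_all _ Ioc_subset_Ioi_self)
    have m2 : ∫ x in Ioc 0 η, (c + x ^ 2) * hilbertTransform f x ^ 2 ≤
        ∫ x in Ioi (0 : ℝ), (c + x ^ 2) * hilbertTransform f x ^ 2 :=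
      setIntegral_mono_set hwH.integrableOn (ae_of_all _ fun x => by positivity) (ae_of_all _ Ioc_subset_Ioi_self)
    have n1 : 0 ≤ ∫ x in Ioc 0 η, (c + x ^ 2)⁻¹ :=
      integral_nonneg fun x => (inv_pos.2 (by positivity : (0 : ℝ) < c + x ^ 2)).le
    have n2 : 0 ≤ ∫ x in Ioc 0 η, (c + x ^ 2) * hilbertTransform f x ^ 2 := integral_nonneg fun x => by positivity
    calc (∫ x in Ioc 0 η, (c + x ^ 2)⁻¹) * ∫ x in Ioc 0 η, (c + x ^ 2) * hilbertTransform f x ^ 2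
        ≤ (∫ x in Ioi (0 : ℝ), (c + x ^ 2)⁻¹) * ∫ x in Ioi (0 : ℝ), (c + x ^ 2) * hilbertTransform f x ^ 2 :=
          mul_le_mul m1 m2 n2 (n1.trans m1)
      _ = π / (4 * Real.sqrt c) * ∫ x, (c + x ^ 2) * f x ^ 2 := by rw [hwint, hhalf]; ring
  rcases le_or_gt 0 ξ with hξ | hξ
  · exact key ξ hξ
  · -- `ξ < 0`: `∫₀^ξ Hf = −∫₀^{−ξ} Hf` by evenness
    have hsymm : ∫ t in (0 : ℝ)..ξ, hilbertTransform f t = -∫ t in (0 : ℝ)..(-ξ), hilbertTransform f t := by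
      have h1 : ∫ t in (0 : ℝ)..ξ, hilbertTransform f t = ∫ t in (0 : ℝ)..ξ, hilbertTransform f (-t) := by
        simp_rw [heven]
      rw [h1, intervalIntegral.integral_comp_neg, neg_zero, intervalIntegral.integral_symm]
    rw [hsymm, neg_sq]
    exact key (-ξ) (by linarith)

end Literature.Analysis.Fourier
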